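import Mathlib
import Summits.ValiantsHypothesis.ValiantsHypothesis.Theorems.MonotoneRestorationMixingScaleMixingProved
import Summits.ValiantsHypothesis.ValiantsHypothesis.Theorems.MonotoneRestorationOrbitRestorationQPPiSigmaValue
import HarnessLib

/-!
# Line `mixing-scale` (crux `OrbitRestorationQP`, stmt-ValiantsHypothesis-18293): the input A₁ DISCHARGED

Route MonotoneRestoration, line `mixing-scale` (val-idea-12), namespace
`Summit.ValiantsHypothesis.ValiantsHypothesis.Theorems.OrbitRestorationQPMixingScale`.  The line's named input
`PiSigmaValue` (A₁ — the `ΠΣ` sub-rung of the line of record `depth-three-rung` in value currency, verbatim the registered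
stub `stub_piSigmaValue`) entered the landed chain BY NAME as the hypothesis `hA1` of `growingFaninRestoration_of_rankBound`
and `productDepthRestorationQP_one_of_residual_of_rankBound` (`…MixingScaleMixingProved.lean`).  It is now a THEOREM
(`OrbitRestorationQPDepthThreeRung.stub_piSigmaValue`, `…OrbitRestorationQPPiSigmaValue.lean`: rule M2′ — keyed blocks by
the parities of the row/column fibre sign counts), and this file records the chain with that hypothesis removed:

* `piSigmaValue_holds : PiSigmaValue`;
* `growingFaninRestoration_of_rankBound' : depthThree_rankBound → GrowingFaninRestoration` — restoration for GROWING top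
  fan-in from the Saxena–Seshadhri rank bound ALONE;
* `productDepthRestorationQP_one_of_residual_of_rankBound'` — the rung `ProductDepthRestorationQP 1` from the declared
  residual and the rank bound.

Remaining named inputs of the line: `depthThree_rankBound` (Saxena–Seshadhri 2013 Thm 5, UNPROVED in the tree) and the
declared residual `GrowingFaninResidual`.  Honest framing: CONDITIONAL results; the crux `OrbitRestorationQP` (stmt-18293)
is NOT closed and `VP ≠ VNP` is NOT proved or moved. [cite: SaxenaSeshadhri2013, Theorem 5]
-/

noncomputable section

open Literature.Computability.AlgebraicComplexity

-- `Summit.ValiantsHypothesis.ValiantsHypothesis.…` is the tree's single-conjunct layout (Sub = Summit).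
set_option linter.dupNamespace false

namespace Summit.ValiantsHypothesis.ValiantsHypothesis.Theorems.OrbitRestorationQPMixingScale

open OrbitRestorationQPDepthThreeRung

/-- **A₁ holds**: the named input `PiSigmaValue` of line `mixing-scale` is the theorem `stub_piSigmaValue`. [folklore] -/
theorem piSigmaValue_holds : PiSigmaValue := stub_piSigmaValue

/-- **Growing top fan-in from the rank bound alone**: the depth-three rank bound ⇒ `GrowingFaninRestoration`
(A₁ and product mixing in `𝔄_n` are now theorems). [cite: SaxenaSeshadhri2013, Theorem 5] -/
theorem growingFaninRestoration_of_rankBound' (hRB : depthThree_rankBound) : GrowingFaninRestoration :=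
  growingFaninRestoration_of_rankBound hRB piSigmaValue_holds

/-- **The rung `ProductDepthRestorationQP 1` modulo the declared residual, from the rank bound alone.**
[cite: SaxenaSeshadhri2013, Theorem 5] -/
theorem productDepthRestorationQP_one_of_residual_of_rankBound' (hres : GrowingFaninResidual)
    (hRB : depthThree_rankBound) : ProductDepthRestorationQP (fun _ => 1) :=
  productDepthRestorationQP_one_of_residual_of_rankBound hres hRB piSigmaValue_holds

end Summit.ValiantsHypothesis.ValiantsHypothesis.Theorems.OrbitRestorationQPMixingScale

end
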